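import Summits.CriticalPhenomena.PercolationContinuityZ3.Theorems.Transplant.Slab111SK4Defs
import HarnessLib

/-!
# Small thickness `(111)`-films, radius FOUR, I′: EXPLICIT-ROUTE plans and the tagged certificate format

builds on p205010 (kernel theorem, internal audit signed; external expert review pending) — NOT used in this file.  Lane `prim-bschramm`, seat
`prim-bschramm-p2` (gen 38; class C1b; memo `HOME/bschramm/P2-LATTICES.md` §136 (9)–(11)); helper file (`--supports stmt-CriticalPhenomena-4575 --as helper`).
The canonical-BFS plans of «Slab111SK4Defs» (`Ctx4.coverOf`, one `avoid` set for all four paths) cannot express every swap pair: at `k = 3` a handful of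
certified triples of the radius-4 blocks need routes whose first path must avoid a vertex that the second path must use (memo §136 (12)).  This file adds
plans with EXPLICIT routes — `Ctx4.coverOfX e₁ e₂ c₁ y b c₂ A Y A₂ B`: the four index lists are only RE-VALIDATED (`pathOK4`, `endsOK`), the branches still come
from reachability — and a TAGGED certificate stream (`Ctx4.checkEsX`: per plan a tag digit, `0` = BFS plan, `1` = explicit plan).  Soundness: «Slab111SK4CaseX».
[cite: DuminilCopinSidoraviciusTassion2016, §2.3 (proof of Fact 2: the three disjoint paths in B_R(z))]
-/

namespace Summit.CriticalPhenomena.PercolationContinuityZ3.Theorems.Transplant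

namespace Slab111.SK4

open Slab111.SK (bitOf sdiff maskBelow maskOfList endsOK orFold rd rdMask)

/-- The static admissibility of a hub quadruple for the pair `(e₁, e₂)` (as in `Ctx4.coverOf`, without an `avoid` set). [folklore] -/
def Ctx4.staticX (C : Ctx4) (e1 e2 c1 y b c2 : ℕ) : Bool :=
  let WR := C.WR
  (e1 != e2) && (y != b) && (y != e1) && (b != e1) && (b != e2) && (c1 != e2) && (c2 != e2) && (y != e2) &&
    ((c1 == e1) || Nat.testBit WR c1) && ((c2 == e1) || Nat.testBit WR c2) && Nat.testBit WR y && Nat.testBit WR b && Nat.testBit C.W b &&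
    adjB4 c1 y && adjB4 c1 b && adjB4 c2 y && adjB4 c2 b && (c1 != y) && (c1 != b) && (c2 != y) && (c2 != b) &&
    Nat.testBit C.univ e1 && Nat.testBit C.univ e2 && Nat.testBit WR e1 && Nat.testBit WR e2

/-- **The cover mask of an EXPLICIT plan**: routes `A : e₁ ⇝ c₁`, `Y : y ⇝ e₂`, `A₂ : e₁ ⇝ c₂`, `B : b ⇝ e₂` given as index lists (re-validated), branches by
reachability: all `w'` reachable from `b` off routing 1 and from `y` off routing 2; `0` if anything is invalid.
[cite: DuminilCopinSidoraviciusTassion2016, §2.3 (proof of Fact 2)] -/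
def Ctx4.coverOfX (C : Ctx4) (e1 e2 c1 y b c2 : ℕ) (A Y A2 B : List ℕ) : ℕ :=
  let u := C.univ
  let W := C.W
  let WR := C.WR
  bif !(C.staticX e1 e2 c1 y b c2) then 0 else
  let mA := maskOfList A
  let mA2 := maskOfList A2
  bif !(pathOK4 (WR ||| bitOf e1 ||| bitOf c1) A 0 && endsOK A e1 c1 && pathOK4 (sdiff (WR ||| bitOf e2) mA) Y 0 && endsOK Y y e2) then 0 else
  bif !(pathOK4 (WR ||| bitOf e1 ||| bitOf c2) A2 0 && endsOK A2 e1 c2 && pathOK4 (sdiff (WR ||| bitOf e2) mA2) B 0 && endsOK B b e2) then 0 else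
  reach4 u (sdiff W (mA ||| maskOfList Y)) (bitOf b) &&& reach4 u (sdiff W (mA2 ||| maskOfList B)) (bitOf y)

/-- Read `cnt` digits into a list of indices (in stream order). [folklore] -/
def rdList : ℕ → ℕ → List ℕ → List ℕ × ℕ
  | 0, n, acc => (acc.reverse, n)
  | cnt + 1, n, acc => let p := rd n; rdList cnt p.2 (p.1 :: acc)

/-- Read `cnt` TAGGED plans for the pair `(e₁, e₂)` and accumulate their cover masks: tag `0` = BFS plan `(c₁ y b c₂ |avoid| avoid…)`, any other tag =
explicit plan `(c₁ y b c₂ |A| A… |Y| Y… |A₂| A₂… |B| B…)`. [folklore] -/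
def Ctx4.rdPlansX (C : Ctx4) (e1 e2 : ℕ) : ℕ → ℕ → ℕ → ℕ × ℕ
  | 0, n, acc => (acc, n)
  | cnt + 1, n, acc =>
    let t := rd n
    let p1 := rd t.2; let p2 := rd p1.2; let p3 := rd p2.2; let p4 := rd p3.2
    bif t.1 == 0 then
      let p5 := rd p4.2
      let av := rdMask p5.1 p5.2 0
      let cov := C.coverOf e1 e2 p1.1 p2.1 p3.1 p4.1 av.1
      C.rdPlansX e1 e2 cnt av.2 (bif cov == 0 then acc else acc ||| cov)
    else
      let nA := rd p4.2; let lA := rdList nA.1 nA.2 []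
      let nY := rd lA.2; let lY := rdList nY.1 nY.2 []
      let nA2 := rd lY.2; let lA2 := rdList nA2.1 nA2.2 []
      let nB := rd lA2.2; let lB := rdList nB.1 nB.2 []
      let cov := C.coverOfX e1 e2 p1.1 p2.1 p3.1 p4.1 lA.1 lY.1 lA2.1 lB.1
      C.rdPlansX e1 e2 cnt lB.2 (bif cov == 0 then acc else acc ||| cov)

/-- Check all partners `e₂` of `e₁` against the tagged certificate numeral `n`. [folklore] -/
def Ctx4.checkRowX (C : Ctx4) (e1 : ℕ) : List ℕ → ℕ → Bool
  | [], _ => true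
  | e2 :: rest, n =>
    bif e2 == e1 then C.checkRowX e1 rest n else
    let need := C.needMask e1 e2
    bif need == 0 then C.checkRowX e1 rest n else
    let p := rd n
    let r := C.rdPlansX e1 e2 p.1 p.2 0
    bif sdiff need r.1 == 0 then C.checkRowX e1 rest r.2 else false

/-- **The chunk checker for tagged certificates.** [folklore] -/
def Ctx4.checkEsX (C : Ctx4) : List ℕ → List ℕ → Bool
  | [], _ => true
  | e1 :: rest, certs =>
    match certs with
    | [] => false
    | n :: certs' => bif C.checkRowX e1 C.esList n then C.checkEsX rest certs' else false

end Slab111.SK4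

end Summit.CriticalPhenomena.PercolationContinuityZ3.Theorems.Transplant
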